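import Summits.PneNP.PneNP.Theorems.ExpanderLinearGeneratorsResKTrees
import HarnessLib

/-!
# The `Res(k)` rung for expanding linear systems, VI: counting over product spaces

Support file for `stmt-PneNP-11443`. Elementary counting identities over the uniform spaces of
functions `Fin V → κ` (`κ = Fin M` for the membership coins of the random variable set `J`,
`κ = Bool` for the random values), which replace probabilistic independence in the switching
argument:

* `card_filter_eqOn`: the functions with prescribed values on a set `P` number `|κ|^{V - |P|}`;
* `prod_one_sub_indicator_eq` : for pairwise variable-disjoint families, the INCLUSION–EXCLUSION
  identity `∑_f ∏_{t} (1 - a·𝟙[f ≡ g_t on P_t]) = |κ|^V ∏_t (1 - a |κ|^{-|P_t|})`, giving the exact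
  "independence" product formulas for (a) the number of value assignments satisfying none of a
  family of disjoint consistent terms (`card_forall_not_tsat`), and (b) the generating function
  `∑_u μ^{N(u)}` of the number `N(u)` of disjoint variable sets entirely inside the random set
  `{v : u v = 0}` (`sum_pow_landed_eq`);
* the binomial generating function `∑_u 2^{#{v < n : u v = 0}} = M^V (1 + 1/M)^n`
  (`sum_two_pow_zeros_eq`) and the resulting Markov tail bound (`card_zeros_ge_le`).

[Segerlind–Buss–Impagliazzo 2004, §3 (independence across disjoint terms); folklore]
-/

namespace Summit.PneNP.PneNP.Theorems.ResKRestriction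

open Finset Literature.Computability.Complexity Literature.Computability.MetaComplexity

/-! ### Functions with prescribed values on a set -/

section Prescribed

variable {ι κ : Type*} [Fintype ι] [DecidableEq ι] [Fintype κ] [DecidableEq κ]

/-- **Functions with prescribed values on `P`** number `|κ|^{|ι| - |P|}`. [folklore] -/
theorem card_filter_eqOn (P : Finset ι) (g : ι → κ) :
    ((Finset.univ : Finset (ι → κ)).filter fun f => ∀ v ∈ P, f v = g v).card =
      Fintype.card κ ^ (Fintype.card ι - P.card) := by
  classical
  -- identify the filter with the subtype of functions restricting to `g` on `P`
  have h1 : ((Finset.univ : Finset (ι → κ)).filter fun f => ∀ v ∈ P, f v = g v).card =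
      Fintype.card {x : ι → κ // x ∘ (Subtype.val : {a // a ∈ P} → ι) = g ∘ Subtype.val} := by
    rw [Fintype.card_subtype]
    congr 1
    ext f
    simp only [Finset.mem_filter, Finset.mem_univ, true_and, funext_iff, Function.comp_apply,
      Subtype.forall]
  rw [h1, Fintype.card_congr (Equiv.subtypePreimage (fun a => a ∈ P) (g ∘ Subtype.val)),
    Fintype.card_fun, Fintype.card_subtype_compl, Fintype.card_coe]

end Prescribed

/-! ### Inclusion–exclusion for pairwise disjoint prescriptions -/

section InclExcl

variable {ι κ τ : Type*} [Fintype ι] [DecidableEq ι] [Fintype κ] [DecidableEq κ] [DecidableEq τ]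

/-- **Inclusion–exclusion product formula.** Let `P t` (`t ∈ D`) be pairwise disjoint subsets of
`ι` and `g : ι → κ` a prescription. Then
`∑_f ∏_{t ∈ D} (1 - a · 𝟙[f = g on P t]) = |κ|^{|ι|} ∏_{t ∈ D} (1 - a |κ|^{-|P t|})`:
expand both products over subfamilies `S ⊆ D`; the inner count is `card_filter_eqOn` for the
union of the `P t`, `t ∈ S`. [folklore] -/
theorem sum_prod_one_sub_indicator (D : Finset τ) (P : τ → Finset ι)
    (hdisj : (D : Set τ).PairwiseDisjoint P) (g : ι → κ)
    [∀ (f : ι → κ) (t : τ), Decidable (∀ v ∈ P t, f v = g v)] (a : ℝ) (hκ : 0 < Fintype.card κ) :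
    ∑ f : ι → κ, ∏ t ∈ D, (1 - a * if (∀ v ∈ P t, f v = g v) then 1 else 0) =
      (Fintype.card κ : ℝ) ^ Fintype.card ι *
        ∏ t ∈ D, (1 - a * ((Fintype.card κ : ℝ) ^ (P t).card)⁻¹) := by
  classical
  have hK0 : (Fintype.card κ : ℝ) ≠ 0 := by exact_mod_cast hκ.ne'
  -- expand the left product for each `f`
  have hL : ∀ f : ι → κ, ∏ t ∈ D, (1 - a * if (∀ v ∈ P t, f v = g v) then (1 : ℝ) else 0) =
      ∑ S ∈ D.powerset, (-a) ^ S.card * if (∀ t ∈ S, ∀ v ∈ P t, f v = g v) then 1 else 0 := by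
    intro f
    have : ∀ t ∈ D, (1 - a * if (∀ v ∈ P t, f v = g v) then (1 : ℝ) else 0) =
        (-a * if (∀ v ∈ P t, f v = g v) then (1 : ℝ) else 0) + 1 := fun t _ => by ring
    rw [Finset.prod_congr rfl this, Finset.prod_add]
    refine Finset.sum_congr rfl fun S hS => ?_
    rw [Finset.prod_const_one, mul_one, Finset.prod_mul_distrib, Finset.prod_const, Finset.prod_boole]
  -- expand the right product
  have hR : ∏ t ∈ D, (1 - a * ((Fintype.card κ : ℝ) ^ (P t).card)⁻¹) =
      ∑ S ∈ D.powerset, (-a) ^ S.card * ((Fintype.card κ : ℝ) ^ (∑ t ∈ S, (P t).card))⁻¹ := by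
    have : ∀ t ∈ D, (1 - a * ((Fintype.card κ : ℝ) ^ (P t).card)⁻¹) =
        (-a * ((Fintype.card κ : ℝ) ^ (P t).card)⁻¹) + 1 := fun t _ => by ring
    rw [Finset.prod_congr rfl this, Finset.prod_add]
    refine Finset.sum_congr rfl fun S hS => ?_
    rw [Finset.prod_const_one, mul_one, Finset.prod_mul_distrib, Finset.prod_const,
      Finset.prod_inv_distrib, Finset.prod_pow_eq_pow_sum]
  simp_rw [hL]
  rw [Finset.sum_comm, hR, Finset.mul_sum]
  refine Finset.sum_congr rfl fun S hS => ?_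
  rw [← Finset.mul_sum, Finset.sum_boole]
  have hSD : S ⊆ D := Finset.mem_powerset.1 hS
  -- the inner count: functions agreeing with `g` on the disjoint union of the `P t`, `t ∈ S`
  have hcount : ∀ inst : DecidablePred fun f : ι → κ => ∀ t ∈ S, ∀ v ∈ P t, f v = g v,
      ((@Finset.filter _ (fun f => ∀ t ∈ S, ∀ v ∈ P t, f v = g v) inst
        (Finset.univ : Finset (ι → κ))).card : ℝ)
      = (Fintype.card κ : ℝ) ^ (Fintype.card ι - (S.biUnion P).card) := by
    intro inst
    have := card_filter_eqOn (κ := κ) (S.biUnion P) g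
    rw [← Nat.cast_pow, ← this]
    norm_cast
    congr 1
    ext f; simp only [Finset.mem_filter, Finset.mem_univ, true_and, Finset.mem_biUnion,
      forall_exists_index, and_imp]
    exact ⟨fun h v t ht hv => h t ht v hv, fun h t ht v hv => h v t ht hv⟩
  rw [hcount, Finset.card_biUnion (fun t ht t' ht' hne => hdisj (hSD ht) (hSD ht') hne)]
  have hle : ∑ t ∈ S, (P t).card ≤ Fintype.card ι := by
    rw [← Finset.card_biUnion (fun t ht t' ht' hne => hdisj (hSD ht) (hSD ht') hne)]
    exact Finset.card_le_univ _
  rw [mul_left_comm]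
  congr 1
  rw [eq_mul_inv_iff_mul_eq₀ (pow_ne_zero _ hK0), ← pow_add, Nat.sub_add_cancel hle]

end InclExcl

/-! ### (a) Values: assignments satisfying none of a family of disjoint consistent terms -/

/-- Extension of `y : Fin V → Bool` to all of `ℕ` by `false`. [folklore] -/
def extb {V : ℕ} (y : Fin V → Bool) : ℕ → Bool :=
  fun w => if h : w < V then y ⟨w, h⟩ else false

/-- `extb y` on `Fin V`. [folklore] -/
@[simp] theorem extb_apply_fin {V : ℕ} (y : Fin V → Bool) (v : Fin V) : extb y v = y v := by
  simp [extb, v.2]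

/-- `extb y` vanishes from `V` on. [folklore] -/
theorem extb_apply_of_le {V : ℕ} (y : Fin V → Bool) {w : ℕ} (hw : V ≤ w) : extb y w = false := by
  simp [extb, Nat.not_lt.2 hw]

/-- The term `t` (all of whose variables are `< V`) is satisfied by the total assignment `extb y`.
[folklore] -/
def TSat {V : ℕ} (y : Fin V → Bool) (t : Finset (Literal ℕ)) : Prop :=
  ∀ l ∈ t, extb y l.1 = l.2

/-- `TSat` is decidable. [folklore] -/
instance {V : ℕ} (y : Fin V → Bool) (t : Finset (Literal ℕ)) : Decidable (TSat y t) := by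
  unfold TSat; infer_instance

/-- The coordinates of a term inside `Fin V`. [folklore] -/
def tfin (V : ℕ) (t : Finset (Literal ℕ)) : Finset (Fin V) :=
  Finset.univ.filter fun v => (v : ℕ) ∈ tvars t

/-- `|tfin V t| = |t|` for a consistent term with variables `< V`. [folklore] -/
theorem card_tfin {V : ℕ} {t : Finset (Literal ℕ)} (ht : TConsistent t) (hV : ∀ l ∈ t, l.1 < V) :
    (tfin V t).card = t.card := by
  -- `l ↦ ⟨l.1, _⟩` is a bijection from `t` onto `tfin V t`
  symm
  refine Finset.card_bij (fun l hl => ⟨l.1, hV l hl⟩) (fun l hl => ?_) (fun l hl l' hl' h => ?_)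
    (fun v hv => ?_)
  · simp only [tfin, Finset.mem_filter, Finset.mem_univ, true_and]
    exact mem_tvars.2 ⟨l.2, by simpa using hl⟩
  · have h1 : l.1 = l'.1 := by simpa using h
    rcases l with ⟨x, b⟩; rcases l' with ⟨x', b'⟩
    simp only at h1; subst h1
    by_contra hne
    have hb : b' = !b := by
      cases b <;> cases b' <;> simp_all
    subst hb
    exact ht _ hl (by simpa [Literal.negate] using hl')
  · simp only [tfin, Finset.mem_filter, Finset.mem_univ, true_and] at hv
    obtain ⟨b, hb⟩ := mem_tvars.1 hv
    exact ⟨(v, b), hb, rfl⟩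

/-- **Exact count**: for a family `D` of pairwise variable-disjoint consistent terms with variables
`< V`, the assignments `y : Fin V → Bool` satisfying none of them number
`2^V ∏_{t ∈ D} (1 - 2^{-|t|})`. [Segerlind–Buss–Impagliazzo 2004, §3] [folklore] -/
theorem card_forall_not_tsat {V : ℕ} (D : Finset (Finset (Literal ℕ))) (hdisj : PairwiseDisjointVars D)
    (hcons : ∀ t ∈ D, TConsistent t) (hV : ∀ t ∈ D, ∀ l ∈ t, l.1 < V) :
    (((Finset.univ : Finset (Fin V → Bool)).filter fun y => ∀ t ∈ D, ¬ TSat y t).card : ℝ) =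
      (2 : ℝ) ^ V * ∏ t ∈ D, (1 - ((2 : ℝ) ^ t.card)⁻¹) := by
  classical
  -- a global prescription `g` consistent with every term of `D`
  let g : Fin V → Bool := fun v => decide (((v : ℕ), true) ∈ D.biUnion id)
  have hg : ∀ t (ht : t ∈ D) l (hl : l ∈ t), g ⟨l.1, hV t ht l hl⟩ = l.2 := by
    intro t ht l hl
    rcases l with ⟨x, b⟩
    cases b
    · -- `(x, true)` is in no term of `D`
      simp only [g, decide_eq_false_iff_not, Finset.mem_biUnion, id_eq, not_exists, not_and]
      intro t' ht' hx
      by_cases htt : t = t'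
      · subst htt; exact hcons t ht _ hl (by simpa [Literal.negate] using hx)
      · have := hdisj t ht t' ht' htt
        rw [Finset.disjoint_left] at this
        exact this (mem_tvars.2 ⟨false, hl⟩) (mem_tvars.2 ⟨true, hx⟩)
    · simp only [g, decide_eq_true_eq, Finset.mem_biUnion, id_eq]
      exact ⟨t, ht, hl⟩
  -- `TSat y t` iff `y` agrees with `g` on `tfin V t`
  have hsat : ∀ t ∈ D, ∀ y : Fin V → Bool, TSat y t ↔ ∀ v ∈ tfin V t, y v = g v := by
    intro t ht y
    constructor
    · intro h v hv
      simp only [tfin, Finset.mem_filter, Finset.mem_univ, true_and] at hv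
      obtain ⟨b, hb⟩ := mem_tvars.1 hv
      have h1 : extb y v = b := h _ hb
      have h2 : g v = b := hg t ht _ hb
      rw [← extb_apply_fin y v, h1, h2]
    · intro h l hl
      have hv : (⟨l.1, hV t ht l hl⟩ : Fin V) ∈ tfin V t := by
        simp only [tfin, Finset.mem_filter, Finset.mem_univ, true_and]
        exact mem_tvars.2 ⟨l.2, by simp [hl]⟩
      have := h _ hv
      rw [hg t ht l hl] at this
      rw [← this]; exact extb_apply_fin y ⟨l.1, hV t ht l hl⟩
  -- rewrite the count as a sum of products of indicators and apply inclusion–exclusion with `a = 1`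
  have hdisj' : (D : Set (Finset (Literal ℕ))).PairwiseDisjoint (tfin V) := by
    intro t ht t' ht' hne
    have := hdisj t ht t' ht' hne
    change Disjoint (tfin V t) (tfin V t')
    rw [Finset.disjoint_left] at this ⊢
    intro v hv hv'
    simp only [tfin, Finset.mem_filter, Finset.mem_univ, true_and] at hv hv'
    exact this hv hv'
  have key := sum_prod_one_sub_indicator (κ := Bool) D (tfin V) hdisj' g 1 (by simp)
  simp only [one_mul, Fintype.card_bool, Fintype.card_fin, Nat.cast_ofNat] at key
  have hprod : ∏ t ∈ D, (1 - ((2 : ℝ) ^ (tfin V t).card)⁻¹) = ∏ t ∈ D, (1 - ((2 : ℝ) ^ t.card)⁻¹) :=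
    Finset.prod_congr rfl fun t ht => by rw [card_tfin (hcons t ht) (hV t ht)]
  rw [hprod] at key
  rw [← key]
  rw [Finset.natCast_card_filter]
  refine Finset.sum_congr rfl fun y _ => ?_
  by_cases h : ∀ t ∈ D, ¬ TSat y t
  · rw [if_pos h, Finset.prod_eq_one]
    intro t ht
    rw [if_neg ((hsat t ht y).not.1 (h t ht))]; ring
  · rw [if_neg h]
    push Not at h
    obtain ⟨t, ht, hts⟩ := h
    exact (Finset.prod_eq_zero ht (by rw [if_pos ((hsat t ht y).1 hts)]; ring)).symm

/-! ### (b) Membership: the generating function of the number of landed terms -/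

/-- The term `t` LANDS in the zero set of `u`: all its coordinates (inside `Fin V`) are sent to
`0`, i.e. all its variables belong to the random set `J = {v : u v = 0}`. [folklore] -/
def Landed {V M : ℕ} (u : Fin V → Fin M) (t : Finset (Literal ℕ)) : Prop :=
  ∀ v ∈ tfin V t, ((u v : ℕ)) = 0

/-- `Landed` is decidable. [folklore] -/
instance {V M : ℕ} (u : Fin V → Fin M) (t : Finset (Literal ℕ)) : Decidable (Landed u t) := by
  unfold Landed; infer_instance

/-- `|tfin V t| ≤ |t|`. [folklore] -/
theorem card_tfin_le {V : ℕ} (t : Finset (Literal ℕ)) : (tfin V t).card ≤ t.card := by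
  calc (tfin V t).card ≤ (tvars t).card := by
        refine Finset.card_le_card_of_injOn (fun v => (v : ℕ)) (fun v hv => ?_) ?_
        · simp only [tfin, Finset.coe_filter, Finset.mem_univ, true_and, Set.mem_setOf_eq] at hv
          exact hv
        · intro v _ v' _ h; exact Fin.ext h
    _ ≤ t.card := card_tvars_le t

/-- **Generating function of the number of landed terms.** For a family `D` of terms with pairwise
disjoint variable sets and at most `k` coordinates each, `0 ≤ μ ≤ 1` and `M ≥ 1`:
`∑_u μ^{#{t ∈ D landed in u}} ≤ M^V (1 - (1 - μ)/M^k)^{|D|}` — the exact value being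
`M^V ∏_t (1 - (1-μ) M^{-|tfin t|})` by inclusion–exclusion. [Segerlind–Buss–Impagliazzo 2004, §3]
[folklore] -/
theorem sum_pow_landed_le {V M k : ℕ} (hM : 1 ≤ M) (D : Finset (Finset (Literal ℕ)))
    (hdisj : PairwiseDisjointVars D) (hk : ∀ t ∈ D, (tfin V t).card ≤ k) {μ : ℝ} (hμ0 : 0 ≤ μ)
    (hμ1 : μ ≤ 1) :
    ∑ u : Fin V → Fin M, μ ^ (D.filter (Landed u)).card ≤
      (M : ℝ) ^ V * (1 - (1 - μ) * ((M : ℝ) ^ k)⁻¹) ^ D.card := by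
  have hMpos : 0 < M := hM
  let z : Fin M := ⟨0, hMpos⟩
  have hdisj' : (D : Set (Finset (Literal ℕ))).PairwiseDisjoint (tfin V) := by
    intro t ht t' ht' hne
    have := hdisj t ht t' ht' hne
    change Disjoint (tfin V t) (tfin V t')
    rw [Finset.disjoint_left] at this ⊢
    intro v hv hv'
    simp only [tfin, Finset.mem_filter, Finset.mem_univ, true_and] at hv hv'
    exact this hv hv'
  have key := sum_prod_one_sub_indicator (κ := Fin M) D (tfin V) hdisj' (fun _ => z) (1 - μ)
    (by simp [hMpos])
  simp only [Fintype.card_fin] at key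
  -- the summands agree: `μ^{#landed} = ∏_t (1 - (1-μ)𝟙[landed])`
  have hsum : ∑ u : Fin V → Fin M, μ ^ (D.filter (Landed u)).card =
      ∑ f : Fin V → Fin M, ∏ t ∈ D, (1 - (1 - μ) * if (∀ v ∈ tfin V t, f v = z) then 1 else 0) := by
    refine Finset.sum_congr rfl fun u _ => ?_
    rw [← Finset.prod_const, Finset.prod_filter]
    refine Finset.prod_congr rfl fun t _ => ?_
    have : Landed u t ↔ ∀ v ∈ tfin V t, u v = z := by
      unfold Landed
      refine forall₂_congr fun v _ => ?_
      rw [Fin.ext_iff]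
    by_cases h : Landed u t
    · rw [if_pos h, if_pos (this.1 h)]; ring
    · rw [if_neg h, if_neg (fun h' => h (this.2 h'))]; ring
  rw [hsum]
  refine key.le.trans (mul_le_mul_of_nonneg_left ?_ (by positivity))
  rw [← Finset.prod_const]
  refine Finset.prod_le_prod (fun t _ => ?_) fun t ht => ?_
  · have h1 : ((M : ℝ) ^ (tfin V t).card)⁻¹ ≤ 1 := by
      apply inv_le_one_of_one_le₀
      exact one_le_pow₀ (by exact_mod_cast hM)
    have h0 : (0 : ℝ) ≤ ((M : ℝ) ^ (tfin V t).card)⁻¹ := by positivity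
    nlinarith
  · have h2 : ((M : ℝ) ^ k)⁻¹ ≤ ((M : ℝ) ^ (tfin V t).card)⁻¹ := by
      apply inv_anti₀ (pow_pos (by exact_mod_cast hMpos) _)
      exact pow_le_pow_right₀ (by exact_mod_cast hM) (hk t ht)
    nlinarith

/-! ### (c) The size of the random set: a binomial tail -/

/-- The number of zero coordinates of `u` below `n`. [folklore] -/
def zeros {V M : ℕ} (n : ℕ) (u : Fin V → Fin M) : ℕ :=
  ((Finset.univ : Finset (Fin V)).filter fun v : Fin V => (v : ℕ) < n ∧ ((u v : ℕ)) = 0).card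

/-- **Binomial generating function**: `∑_u 2^{zeros n u} = M^V (1 + 1/M)^{#{v : v < n}}` for
`n ≤ V`, `M ≥ 1`. [folklore] -/
theorem sum_two_pow_zeros_eq {V M n : ℕ} (hM : 1 ≤ M) (hn : n ≤ V) :
    ∑ u : Fin V → Fin M, (2 : ℝ) ^ zeros n u = (M : ℝ) ^ V * (1 + ((M : ℝ))⁻¹) ^ n := by
  have hMpos : 0 < M := hM
  let z : Fin M := ⟨0, hMpos⟩
  let Fn : Finset (Fin V) := Finset.univ.filter fun v : Fin V => (v : ℕ) < n
  have hFn : Fn.card = n := by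
    -- `v ↦ (v : ℕ)` is a bijection from `Fn` onto `range n`
    rw [← Finset.card_range n]
    refine Finset.card_bij (fun v _ => (v : ℕ)) (fun v hv => ?_) (fun v _ v' _ h => Fin.ext h)
      (fun w hw => ?_)
    · simp only [Fn, Finset.mem_filter, Finset.mem_univ, true_and] at hv
      exact Finset.mem_range.2 hv
    · rw [Finset.mem_range] at hw
      exact ⟨⟨w, by omega⟩, by simp [Fn, hw], rfl⟩
  have hdisj : (Fn : Set (Fin V)).PairwiseDisjoint (fun v => ({v} : Finset (Fin V))) := by
    intro v _ v' _ hne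
    change Disjoint ({v} : Finset (Fin V)) {v'}
    simpa using hne
  have key := sum_prod_one_sub_indicator (κ := Fin M) Fn (fun v => ({v} : Finset (Fin V))) hdisj
    (fun _ => z) (-1) (by simp [hMpos])
  simp only [Fintype.card_fin, Finset.card_singleton, pow_one, Finset.mem_singleton,
    forall_eq] at key
  have hsum : ∑ u : Fin V → Fin M, (2 : ℝ) ^ zeros n u =
      ∑ f : Fin V → Fin M, ∏ v ∈ Fn, (1 - (-1) * if f v = z then 1 else 0) := by
    refine Finset.sum_congr rfl fun u _ => ?_
    have hz : zeros n u = (Fn.filter fun v => u v = z).card := by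
      unfold zeros
      congr 1
      ext v
      simp only [Finset.mem_filter, Finset.mem_univ, true_and, Fn, Fin.ext_iff]
      rfl
    rw [hz, ← Finset.prod_const, Finset.prod_filter]
    refine Finset.prod_congr rfl fun v _ => ?_
    split_ifs <;> ring
  rw [hsum]
  refine key.trans ?_
  rw [Finset.prod_const, hFn]
  congr 1
  refine congrArg (· ^ n) ?_
  ring

/-- **Binomial tail (Markov on the generating function)**: the number of `u` with at least `a`
zero coordinates below `n` is at most `M^V · exp(n/M) / 2^a`. [folklore] -/
theorem card_zeros_ge_le {V M n : ℕ} (hM : 1 ≤ M) (hn : n ≤ V) (a : ℕ) :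
    ((((Finset.univ : Finset (Fin V → Fin M)).filter fun u => a ≤ zeros n u).card : ℝ)) ≤
      (M : ℝ) ^ V * Real.exp ((n : ℝ) / M) * ((2 : ℝ) ^ a)⁻¹ := by
  classical
  have hgen := sum_two_pow_zeros_eq (V := V) hM hn
  -- Markov: `2^a · #{u : a ≤ zeros} ≤ ∑_u 2^{zeros u}`
  have hmarkov : (2 : ℝ) ^ a * (((Finset.univ : Finset (Fin V → Fin M)).filter fun u => a ≤ zeros n u).card : ℝ)
      ≤ ∑ u : Fin V → Fin M, (2 : ℝ) ^ zeros n u := by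
    rw [Finset.natCast_card_filter, Finset.mul_sum]
    refine Finset.sum_le_sum fun u _ => ?_
    split_ifs with h
    · rw [mul_one]; exact pow_le_pow_right₀ (by norm_num) h
    · rw [mul_zero]; positivity
  have hexp : (1 + ((M : ℝ))⁻¹) ^ n ≤ Real.exp ((n : ℝ) / M) := by
    calc (1 + ((M : ℝ))⁻¹) ^ n ≤ (Real.exp ((M : ℝ))⁻¹) ^ n := by
          apply pow_le_pow_left₀ (by positivity)
          have := Real.add_one_le_exp ((M : ℝ))⁻¹
          linarith
      _ = Real.exp ((n : ℝ) / M) := by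
          rw [← Real.exp_nat_mul, div_eq_mul_inv]
  have h2a : (0 : ℝ) < 2 ^ a := by positivity
  rw [le_mul_inv_iff₀ h2a]
  calc ((((Finset.univ : Finset (Fin V → Fin M)).filter fun u => a ≤ zeros n u).card : ℝ)) * 2 ^ a
      ≤ ∑ u : Fin V → Fin M, (2 : ℝ) ^ zeros n u := by rw [mul_comm]; exact hmarkov
    _ = (M : ℝ) ^ V * (1 + ((M : ℝ))⁻¹) ^ n := hgen
    _ ≤ (M : ℝ) ^ V * Real.exp ((n : ℝ) / M) := by gcongr

end Summit.PneNP.PneNP.Theorems.ResKRestriction
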